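import Literature.MathematicalPhysics.QuantumManyBody.PeriodicBoseGas
import Mathlib.MeasureTheory.Integral.Marginal
import Mathlib.MeasureTheory.Integral.Bochner.ContinuousLinearMap
import HarnessLib

/-!
# Lieb's amplitude gas: the correlation functions `g_p` of a non-negative wave function

Topic `Literature/MathematicalPhysics/QuantumManyBody` (definition item `defn-AmplitudeCorrelation`,
wanted by the cruxes `AmplitudeClustering` / `HierarchyContraction` of route
`AtomisticToContinuum/BECAmplitudeHierarchy`). Units `ħ = 2m = 1` as in the `BoseGas` files; the
torus of side `L` is the fundamental cell `cell L = [0,L)³`, `V = L³`.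

Lieb's 1963 "simplified approach" [Lieb1963] (presented in [Jauslin2025, §4.2] and
[CarlenJauslinLieb2020, §5.1]) treats the non-negative periodic ground state `ψ₀ ≥ 0` of `N` bosons
as an (unnormalised) **probability density** on the torus — the *amplitude gas* `ν = ψ₀/∫ψ₀` — and
studies its correlation functions
`g_p(x₁,…,x_p) := V^p ∫ ψ₀(x₁,…,x_N) dx_{p+1}⋯dx_N / ∫ ψ₀` [Jauslin2025, (4.9);
CarlenJauslinLieb2020, §5.1], which obey the marginal rule `∫ dx_p/V g_p = g_{p-1}`
[Jauslin2025, (4.13)–(4.14)], in terms of which `E₀/N = (N-1)/(2V) ∫ v g₂` [Jauslin2025, (4.6)]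
and the exact level-2 equation of the hierarchy [Jauslin2025, (4.10)] hold; Lieb's approximation
closes the hierarchy by factorising `g₃, g₄` into pair terms [Jauslin2025, Assumption 4.1 (4.11),
Lemmas A4.1–A4.2].

## Contents (all real definitions; `Ψ : Config N → ℂ` enters only through `|Ψ|` on the cell)

* `amplitudeNorm N L Ψ = ∫_{cell^N} |Ψ| ∈ [0,∞]`, `amplitudeMarginal N p L Ψ x = ∫_{cell^{N-p}} |Ψ(x, Y)| dY`
  (the `p` marked particles first, `appendConfig x Y`), and the **correlation function**
  `amplitudeCorrelation N p L Ψ : Config p → ℝ`, `g_p(x) = V^p ∫_{cell^{N-p}} |Ψ(x,Y)| dY / ∫_{cell^N} |Ψ|`.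
* the amplitude gas `amplitudeMeasure N L Ψ = (∫|Ψ|)⁻¹ |Ψ| dX|_{cell^N}` and its expectation
  `amplitudeExpectation N L Ψ f = ∫_{cell^N} |Ψ| f / ∫_{cell^N} |Ψ|` (`E_ν[f]`);
* the pair function as a function of the difference `pairCorrelation N L Ψ r = g₂(r, 0)`
  [Jauslin2025, (4.5)], the pair-product form `pairProductClosure w p x = ∏_{i<j} (1 - w(xᵢ - xⱼ))`
  [Jauslin2025, (4.11)], the Kirkwood superposition `g₂(x₁-x₂)g₂(x₁-x₃)g₂(x₂-x₃)` and the truncation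
  `h₃ = g₃ - g₃^{KSA}` (`truncatedCorrelation3`);
* Lieb's volume-corrected pair terms `w₃ = (1-u)(u ⋆ u)`, `u₃ = u + w₃/V`, `u₄ = u + 2w₃/V`
  [Jauslin2025, (A4.2)–(A4.3), (A4.14)] with `u = 1 - g₂`, the level-3/4 closures
  `∏_{i<j}(1 - u₃(xᵢ-xⱼ))`, `∏_{i<j}(1 - u₄(xᵢ-xⱼ))` [Jauslin2025, (A4.1), (A4.13)] and the
  truncation `h₄ = g₄ - (level-4 closure)` (`truncatedCorrelation4`).

Proved API: the block integral is Mathlib's `lmarginal` over the tail coordinates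
(`amplitudeMarginal_eq_lmarginal`); the **marginal rule** `∫_{cell} (∫_{cell^{N-p-1}} |Ψ(x,y,Y)| dY) dy
= ∫_{cell^{N-p}} |Ψ(x,Y')| dY'` in `ℝ≥0∞` for measurable `Ψ` (`setLIntegral_amplitudeMarginal_snoc`) and
its real form `∫_{cell} g_{p+1}(x, y) dy = V g_p(x)` for bounded measurable `Ψ`
(`setIntegral_amplitudeCorrelation_snoc`, [Jauslin2025, (4.13)]); `g₀ = 1`; `g_p ≥ 0`;
`E_ν[f] = ∫ f dν` (`integral_amplitudeMeasure`) and `ν` is a probability measure; the Kirkwood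
superposition is the pair-product form of `u = 1 - g₂`.

## Design choices

* `Ψ` is a bare function `Config N → ℂ` used only through `X ↦ ‖Ψ X‖` restricted to the cell (so a
  `PeriodicTrialState N L` is used via `Ψ.ψ`); for the Perron–Frobenius ground state `Ψ ≥ 0` this is
  `Ψ` itself [Jauslin2025, §4.2.1]. Periodicity / symmetry / translation invariance are **not**
  built in: they are hypotheses of the theorems that need them.
* The `p` marked particles are the **first** `p` coordinates and the remaining `N - p` are
  integrated out, as printed in (4.9); `appendConfig x Y` juxtaposes `x : Config p` and
  `Y : Config (N - p)` without a cast (for `p > N` nothing is integrated: harmless junk, every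
  statement of interest has `p ≤ N`). `g_p` takes values in `ℝ` (the truncations are signed);
  the unnormalised marginals live in `ℝ≥0∞`, where Tonelli needs no integrability.
* `g₂` "is" a function of `x₁ - x₂` only for translation-invariant `Ψ` [Jauslin2025, (4.5)];
  `pairCorrelation` fixes the representative `(r, 0)`. The identity `g₂(x₁,x₂) = g₂(x₁-x₂,0)` for
  translation-invariant periodic `Ψ` (shift of the fundamental cell, cf.
  `lintegral_cellN_comp_add` in `PeriodicBoseGasEq317`) is not proved here.
* Lieb's closures are taken *exactly* as `u₃ = u + w₃/V`, `u₄ = u + 2w₃/V`, i.e. (A4.2), (A4.14)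
  without the `(1 + O(V⁻²))` factors, which is the form (A4.12), (A4.23) in which they are used;
  the torus integral in `w₃` is over the cell. The plain Kirkwood superposition (`u₃ ↦ u`) is the
  level-3 reference of the route's `h₃`.
* Imports are `PeriodicBoseGas` and Mathlib only, so that no further named facts enter the import
  cone of the routes using this file; two three-line measure-theoretic facts about `cell^N` that
  exist downstream (`PeriodicBoseGasThm31`) are re-proved privately rather than imported.
* Mathlib has no BBGKY-type marginal for a varying particle number (`MeasureTheory.lmarginal` keeps
  the ambient type and is `ℝ≥0∞`-valued; we bridge to it); `Literature.Analysis.FluidPDE.marginal`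
  (hard spheres, whole space, Bochner) lives in the kinetic-theory cone and is not imported.

## References

* [Lieb1963] E. H. Lieb, *Simplified approach to the ground-state energy of an imperfect Bose
  gas*, Phys. Rev. 130 (1963) 2518–2528 (the original; paywalled, acquisition `acq-02378`; read
  through the two presentations below).
* [Jauslin2025] I. Jauslin, *An Introduction to Lieb's Simplified Approach to the Bose Gas*,
  SpringerBriefs in Physics (2025), arXiv:2308.00290: §4.2.1 (4.3)–(4.6), §4.2.2 (4.9)–(4.10),
  §4.2.3 Assumption 4.1 (4.11)–(4.15), App. A4.1 Lemma A4.1 (A4.1)–(A4.3), (A4.12), Lemma A4.2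
  (A4.13)–(A4.14), (A4.23) (numbering of the arXiv text, pp. 19–21 and 56–58).
* [CarlenJauslinLieb2020] E. A. Carlen, I. Jauslin, E. H. Lieb, *Analysis of a simple equation for
  the ground state energy of the Bose gas*, Pure Appl. Anal. 2 (2020) 659–684, §5.1 (definition of
  `g_N^{(p)}`, `E₀ = N(N-1)/(2V) ∫ g_N^{(2)} v`).
-/

noncomputable section

open MeasureTheory Function
open scoped ENNReal NNReal

namespace Literature.MathematicalPhysics.QuantumManyBody.BoseGas

variable {N p : ℕ} {L : ℝ}

/-! ### Juxtaposing and padding configurations -/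

/-- Juxtaposition of a configuration `x` of `p` marked particles with a configuration `Y` of the
remaining `N - p` particles: `(x₁, …, x_p, Y₁, …, Y_{N-p}) ∈ (ℝ³)^N` (for `p > N` only the first
`N` entries of `x` are kept). A cast-free variant of `Fin.append`. [folklore] -/
def appendConfig (x : Config p) (Y : Config (N - p)) : Config N :=
  fun i => if h : (i : ℕ) < p then x ⟨i, h⟩
    else Y ⟨(i : ℕ) - p, Nat.sub_lt_sub_right (Nat.le_of_not_lt h) i.isLt⟩

/-- Below `p`, `appendConfig x Y` reads `x`. [folklore] -/
theorem appendConfig_apply_of_lt (x : Config p) (Y : Config (N - p)) (i : Fin N)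
    (h : (i : ℕ) < p) : appendConfig x Y i = x ⟨i, h⟩ := by
  simp [appendConfig, h]

/-- From `p` on, `appendConfig x Y` reads `Y`. [folklore] -/
theorem appendConfig_apply_of_le (x : Config p) (Y : Config (N - p)) (i : Fin N)
    (h : p ≤ (i : ℕ)) :
    appendConfig x Y i = Y ⟨(i : ℕ) - p, Nat.sub_lt_sub_right h i.isLt⟩ := by
  simp [appendConfig, not_lt.2 h]

/-- With no marked particle, `appendConfig x Y = Y`. [folklore] -/
theorem appendConfig_zero (x : Config 0) (Y : Config (N - 0)) : appendConfig x Y = Y := by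
  funext i
  simp [appendConfig]

/-- Padding of a configuration of `p` particles by the origin to a configuration of `N`
particles (the values beyond `p` are never looked at: they are integrated out). [folklore] -/
def padConfig (N : ℕ) (x : Config p) : Config N :=
  fun i => if h : (i : ℕ) < p then x ⟨i, h⟩ else 0

/-- The tail coordinates `{p, p+1, …, N-1}`, i.e. the particles that are integrated out in `g_p`.
[folklore] -/
def tailSet (N p : ℕ) : Finset (Fin N) :=
  Finset.univ.filter fun i : Fin N => p ≤ (i : ℕ)

/-- Membership in the tail. [folklore] -/
theorem mem_tailSet {i : Fin N} : i ∈ tailSet N p ↔ p ≤ (i : ℕ) := by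
  simp [tailSet]

/-- No tail coordinate is marked when `p = 0`: the tail is everything. [folklore] -/
theorem tailSet_zero : tailSet N 0 = Finset.univ := by
  ext i; simp [tailSet]

/-- Peeling off the first tail coordinate. [folklore] -/
theorem tailSet_eq_insert (hp : p < N) : tailSet N p = insert ⟨p, hp⟩ (tailSet N (p + 1)) := by
  ext i
  simp only [tailSet, Finset.mem_filter, Finset.mem_univ, true_and, Finset.mem_insert,
    Fin.ext_iff]
  omega

/-- The first tail coordinate of `tailSet N p` is not in `tailSet N (p + 1)`. [folklore] -/
theorem notMem_tailSet_succ (hp : p < N) : (⟨p, hp⟩ : Fin N) ∉ tailSet N (p + 1) := by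
  simp [tailSet]

/-- The monotone bijection `j ↦ p + j` between `Fin (N - p)` and the tail coordinates. [folklore] -/
def tailEquiv (N p : ℕ) : Fin (N - p) ≃ ↥(tailSet N p) where
  toFun j := ⟨⟨(j : ℕ) + p, Nat.add_lt_of_lt_sub j.isLt⟩, mem_tailSet.2 (Nat.le_add_left p j)⟩
  invFun i := ⟨((i : Fin N) : ℕ) - p, Nat.sub_lt_sub_right (mem_tailSet.1 i.2) (i : Fin N).isLt⟩
  left_inv j := by ext; simp
  right_inv i := by ext; simp [Nat.sub_add_cancel (mem_tailSet.1 i.2)]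

/-- Padding a snoc-extended marked configuration is updating the padded one at coordinate `p`.
[folklore] -/
theorem padConfig_snoc (hp : p < N) (x : Config p) (y : Space) :
    padConfig N (Fin.snoc x y : Config (p + 1)) = update (padConfig N x) ⟨p, hp⟩ y := by
  funext i
  rcases lt_trichotomy (i : ℕ) p with hi | hi | hi
  · have hne : i ≠ ⟨p, hp⟩ := fun h => by simp [h] at hi
    rw [update_of_ne hne]
    simp only [padConfig, dif_pos hi, dif_pos (Nat.lt_succ_of_lt hi)]
    exact Fin.snoc_castSucc (α := fun _ => Space) (x := y) (p := x) (i := ⟨i, hi⟩)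
  · have heq : i = ⟨p, hp⟩ := Fin.ext hi
    subst heq
    rw [update_self]
    simp only [padConfig, dif_pos (Nat.lt_succ_self p)]
    exact Fin.snoc_last (α := fun _ => Space) (x := y) (p := x)
  · have hne : i ≠ ⟨p, hp⟩ := fun h => by simp [h] at hi
    rw [update_of_ne hne]
    simp [padConfig, not_lt.2 (Nat.succ_le_of_lt hi), not_lt.2 hi.le]

/-- The lmarginal bookkeeping: updating the padded configuration on the tail by (the transport
of) `Y` is juxtaposition with `Y`. [folklore] -/
theorem updateFinset_padConfig (x : Config p) (Y : Config (N - p)) :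
    updateFinset (padConfig N x) (tailSet N p)
        (MeasurableEquiv.piCongrLeft (fun _ : ↥(tailSet N p) => Space) (tailEquiv N p) Y) =
      appendConfig x Y := by
  funext i
  simp only [updateFinset_def]
  by_cases hi : i ∈ tailSet N p
  · rw [dif_pos hi]
    have hpi : p ≤ (i : ℕ) := mem_tailSet.1 hi
    have hj : tailEquiv N p ⟨(i : ℕ) - p, Nat.sub_lt_sub_right hpi i.isLt⟩ = ⟨i, hi⟩ := by
      ext; simp [tailEquiv, Nat.sub_add_cancel hpi]
    rw [← hj, MeasurableEquiv.piCongrLeft_apply_apply, appendConfig_apply_of_le x Y i hpi]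
  · rw [dif_neg hi]
    have hip : (i : ℕ) < p := not_le.1 fun h => hi (mem_tailSet.2 h)
    simp [padConfig, appendConfig, hip]

/-! ### The amplitude gas and its correlation functions -/

/-- The weight `|Ψ(X)|` of the amplitude gas, in `ℝ≥0∞`. [cite: Jauslin2025, §4.2.1] -/
abbrev amplitudeWeight (Ψ : Config N → ℂ) : Config N → ℝ≥0∞ :=
  fun X => ‖Ψ X‖₊

/-- The normalisation `∫_{cell^N} |Ψ| dX ∈ [0, ∞]` of the amplitude gas (for the ground state
`ψ₀ ≥ 0` this is `∫ ψ₀`, the denominator of (4.5), (4.9)). [cite: Jauslin2025, (4.9)] -/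
def amplitudeNorm (N : ℕ) (L : ℝ) (Ψ : Config N → ℂ) : ℝ≥0∞ :=
  ∫⁻ X in cellN N L, amplitudeWeight Ψ X

/-- The unnormalised `p`-particle marginal `∫_{cell^{N-p}} |Ψ(x₁,…,x_p, Y)| dY ∈ [0, ∞]` of the
amplitude gas (the numerator of (4.9) without the factor `V^p`). [cite: Jauslin2025, (4.9)] -/
def amplitudeMarginal (N p : ℕ) (L : ℝ) (Ψ : Config N → ℂ) (x : Config p) : ℝ≥0∞ :=
  ∫⁻ Y in cellN (N - p) L, amplitudeWeight Ψ (appendConfig x Y)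

/-- **Lieb's correlation function** `g_p` of the amplitude gas of `Ψ` on the torus of side `L`
(`V = L³`): `g_p(x₁,…,x_p) = V^p ∫_{cell^{N-p}} |Ψ(x₁,…,x_p,Y)| dY / ∫_{cell^N} |Ψ|`
(Jauslin (4.9); Carlen–Jauslin–Lieb §5.1 `g_N^{(p)}`; Lieb 1963). Real-valued; `0` if
`∫|Ψ| ∈ {0, ∞}`. For `Ψ = ψ₀ ≥ 0` the ground state these are the `g_n` of the hierarchy (4.10).
[cite: Jauslin2025, (4.9)] -/
def amplitudeCorrelation (N p : ℕ) (L : ℝ) (Ψ : Config N → ℂ) (x : Config p) : ℝ :=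
  (L ^ 3) ^ p * (amplitudeMarginal N p L Ψ x).toReal / (amplitudeNorm N L Ψ).toReal

/-- The **amplitude gas** `ν = |Ψ| dX|_{cell^N} / ∫_{cell^N}|Ψ|` as a measure on `(ℝ³)^N`
("`ψ₀/∫ψ₀` is a probability distribution"). [cite: Jauslin2025, §4.2.1] -/
def amplitudeMeasure (N : ℕ) (L : ℝ) (Ψ : Config N → ℂ) : Measure (Config N) :=
  (amplitudeNorm N L Ψ)⁻¹ • ((volume : Measure (Config N)).restrict (cellN N L)).withDensity
    fun X => amplitudeWeight Ψ X

/-- The expectation `E_ν[f] = ∫_{cell^N} f |Ψ| dX / ∫_{cell^N} |Ψ| dX` of an observable `f` in the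
amplitude gas (e.g. (4.4): `E₀ = E_ν[∑_{i<j} v(xᵢ-xⱼ)]`). [cite: Jauslin2025, (4.4)] -/
def amplitudeExpectation (N : ℕ) (L : ℝ) (Ψ : Config N → ℂ) (f : Config N → ℝ) : ℝ :=
  (∫ X in cellN N L, ‖Ψ X‖ * f X) / (amplitudeNorm N L Ψ).toReal

/-- The **pair correlation function as a function of the difference**, `g₂(r) := g₂(r, 0)`; for a
translation-invariant `Ψ` (e.g. the periodic ground state) `g₂(x₁, x₂) = g₂(x₁ - x₂)` and
`E₀/N = (N-1)/(2V) ∫ v g₂`. [cite: Jauslin2025, (4.5)–(4.6)] -/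
def pairCorrelation (N : ℕ) (L : ℝ) (Ψ : Config N → ℂ) (r : Space) : ℝ :=
  amplitudeCorrelation N 2 L Ψ ![r, 0]

/-! ### Closures: pair products, Kirkwood superposition, Lieb's corrected pair terms -/

/-- The **pair-product form** `∏_{1 ≤ i < j ≤ p} (1 - w(xᵢ - xⱼ))` of a `p`-point function
(Lieb's factorisation Assumption: `g_i = ∏_{j<l} (1 - u_i(x_j - x_l))`). [cite: Jauslin2025, Assumption 4.1 (4.11)] -/
def pairProductClosure (w : Space → ℝ) (p : ℕ) (x : Config p) : ℝ :=
  ∏ i : Fin p, ∏ j : Fin p with i < j, (1 - w (x i - x j))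

/-- The **Kirkwood superposition** `g(x₁-x₂) g(x₁-x₃) g(x₂-x₃)` of a pair function `g` (the
level-3 factorisation (4.11) with `u₃ ↦ 1 - g`). [cite: Jauslin2025, Assumption 4.1 (4.11)] -/
def kirkwoodSuperposition (g : Space → ℝ) (x : Config 3) : ℝ :=
  g (x 0 - x 1) * g (x 0 - x 2) * g (x 1 - x 2)

/-- The **truncated three-point function** `h₃ := g₃ - g₂(x₁-x₂)g₂(x₁-x₃)g₂(x₂-x₃)` of the amplitude
gas (defect of the Kirkwood superposition; it vanishes exactly iff the level-3 factorisation
(4.11) holds with `u₃ = 1 - g₂`). [cite: Jauslin2025, Assumption 4.1 (4.11)] -/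
def truncatedCorrelation3 (N : ℕ) (L : ℝ) (Ψ : Config N → ℂ) (x : Config 3) : ℝ :=
  amplitudeCorrelation N 3 L Ψ x - kirkwoodSuperposition (pairCorrelation N L Ψ) x

/-- Lieb's volume correction `w₃(r) = (1 - u(r)) ∫_{cell} u(r - z) u(-z) dz` (A4.3), written at the
representative `(x, y) = (r, 0)` of `x - y = r`; torus integral over the cell.
[cite: Jauslin2025, Lemma A4.1 (A4.3)] -/
def liebW3 (L : ℝ) (u : Space → ℝ) (r : Space) : ℝ :=
  (1 - u r) * ∫ z in cell L, u (r - z) * u (-z)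

/-- Lieb's level-3 pair term `u₃ = u + w₃/V` ((A4.2) without the `(1 + O(V⁻²))` factor, i.e. the
form (A4.12): `1 - u₃ = (1 - u)(1 - V⁻¹ ∫ u(x-z)u(y-z) dz)`). [cite: Jauslin2025, Lemma A4.1 (A4.2)] -/
def liebU3 (L : ℝ) (u : Space → ℝ) (r : Space) : ℝ :=
  u r + liebW3 L u r / L ^ 3

/-- Lieb's level-4 pair term `u₄ = u + 2w₃/V` ((A4.14) without the `(1 + O(V⁻²))` factor, i.e. the
form (A4.23)). [cite: Jauslin2025, Lemma A4.2 (A4.14)] -/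
def liebU4 (L : ℝ) (u : Space → ℝ) (r : Space) : ℝ :=
  u r + 2 * liebW3 L u r / L ^ 3

/-- **Lieb's level-3 closure** `∏_{i<j≤3} (1 - u₃(xᵢ - xⱼ))` of the amplitude gas of `Ψ`, with
`u = 1 - g₂` its pair function (A4.1). [cite: Jauslin2025, Lemma A4.1 (A4.1)] -/
def liebClosure3 (N : ℕ) (L : ℝ) (Ψ : Config N → ℂ) : Config 3 → ℝ :=
  pairProductClosure (liebU3 L fun r => 1 - pairCorrelation N L Ψ r) 3

/-- **Lieb's level-4 closure** `∏_{i<j≤4} (1 - u₄(xᵢ - xⱼ))` of the amplitude gas of `Ψ`, with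
`u = 1 - g₂` its pair function (A4.13). [cite: Jauslin2025, Lemma A4.2 (A4.13)] -/
def liebClosure4 (N : ℕ) (L : ℝ) (Ψ : Config N → ℂ) : Config 4 → ℝ :=
  pairProductClosure (liebU4 L fun r => 1 - pairCorrelation N L Ψ r) 4

/-- The **truncated four-point function** `h₄ := g₄ - ∏_{i<j≤4}(1 - u₄(xᵢ - xⱼ))` of the amplitude
gas: the defect of Lieb's level-4 closure (the closure consistent with the marginal rules (4.14)
to order `V⁻²`). [cite: Jauslin2025, Lemma A4.2 (A4.13)–(A4.14)] -/
def truncatedCorrelation4 (N : ℕ) (L : ℝ) (Ψ : Config N → ℂ) (x : Config 4) : ℝ :=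
  amplitudeCorrelation N 4 L Ψ x - liebClosure4 N L Ψ x

/-- The Kirkwood superposition is the pair-product form with `w = 1 - g`. [cite: Jauslin2025, Assumption 4.1 (4.11)] -/
theorem kirkwoodSuperposition_eq_pairProductClosure (g : Space → ℝ) (x : Config 3) :
    kirkwoodSuperposition g x = pairProductClosure (fun r => 1 - g r) 3 x := by
  simp [kirkwoodSuperposition, pairProductClosure, Finset.prod_filter, Fin.prod_univ_three,
    mul_assoc]

/-! ### Measure-theoretic bookkeeping on the cell -/

/-- `cell^N` is the product set `∏ cell`. [folklore] -/
private theorem cellN_eq_univ_pi (N : ℕ) (L : ℝ) :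
    cellN N L = Set.univ.pi fun _ : Fin N => cell L := by
  ext X; simp [cellN]

/-- Lebesgue measure restricted to `cell^N` is the product of the restrictions to `cell`.
[folklore] -/
private theorem restrict_cellN_eq_pi (N : ℕ) (L : ℝ) :
    (volume : Measure (Config N)).restrict (cellN N L) =
      Measure.pi fun _ : Fin N => (volume : Measure Space).restrict (cell L) := by
  rw [cellN_eq_univ_pi, volume_pi, Measure.restrict_pi_pi]

/-- The weight `|Ψ|` is measurable for measurable `Ψ`. [folklore] -/
theorem measurable_amplitudeWeight {Ψ : Config N → ℂ} (hΨ : Measurable Ψ) :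
    Measurable (amplitudeWeight Ψ) :=
  hΨ.nnnorm.coe_nnreal_ennreal

/-- **Bridge to Mathlib's marginal integral**: the block integral over `cell^{N-p}` is the
`lmarginal` of `|Ψ|` over the tail coordinates, for the cell-restricted Lebesgue measures,
evaluated at the padded marked configuration. [folklore] -/
theorem amplitudeMarginal_eq_lmarginal (Ψ : Config N → ℂ) (x : Config p) :
    amplitudeMarginal N p L Ψ x =
      (∫⋯∫⁻_(tailSet N p), amplitudeWeight Ψ
        ∂(fun _ : Fin N => (volume : Measure Space).restrict (cell L))) (padConfig N x) := by
  rw [amplitudeMarginal, restrict_cellN_eq_pi, lmarginal]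
  have hmp := measurePreserving_piCongrLeft
    (fun _ : ↥(tailSet N p) => (volume : Measure Space).restrict (cell L)) (tailEquiv N p)
  rw [← hmp.lintegral_comp_emb (MeasurableEquiv.measurableEmbedding _)]
  refine lintegral_congr fun Y => ?_
  rw [updateFinset_padConfig]

/-- `g₀`'s numerator is the normalisation: `∫_{cell^{N-0}} |Ψ(Y)| dY = ∫_{cell^N} |Ψ|`. [folklore] -/
theorem amplitudeMarginal_zero (Ψ : Config N → ℂ) (x : Config 0) :
    amplitudeMarginal N 0 L Ψ x = amplitudeNorm N L Ψ := by
  change (∫⁻ Y in cellN N L, amplitudeWeight Ψ (appendConfig x Y)) = ∫⁻ X in cellN N L, _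
  simp only [appendConfig_zero]

/-- A uniform bound `|Ψ| ≤ C` bounds the weight in `ℝ≥0∞`. [folklore] -/
theorem amplitudeWeight_le {Ψ : Config N → ℂ} {C : ℝ} (hC : ∀ X, ‖Ψ X‖ ≤ C) (X : Config N) :
    amplitudeWeight Ψ X ≤ ENNReal.ofReal C := by
  have h : ‖Ψ X‖₊ ≤ C.toNNReal := by
    rw [← norm_toNNReal]
    exact Real.toNNReal_le_toNNReal (hC X)
  exact ENNReal.coe_le_coe.2 h

/-- For bounded `Ψ` every marginal is finite (`≤ C · V^{N-p}`). [folklore] -/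
theorem amplitudeMarginal_lt_top {Ψ : Config N → ℂ} {C : ℝ} (hC : ∀ X, ‖Ψ X‖ ≤ C)
    (x : Config p) : amplitudeMarginal N p L Ψ x < ∞ := by
  refine lt_of_le_of_lt (lintegral_mono fun Y => amplitudeWeight_le hC _) ?_
  rw [setLIntegral_const, volume_cellN]
  exact ENNReal.mul_lt_top ENNReal.ofReal_lt_top
    (ENNReal.pow_lt_top (ENNReal.pow_lt_top ENNReal.ofReal_lt_top))

/-- For bounded `Ψ` the normalisation `∫_{cell^N}|Ψ|` is finite. [folklore] -/
theorem amplitudeNorm_lt_top {Ψ : Config N → ℂ} {C : ℝ} (hC : ∀ X, ‖Ψ X‖ ≤ C) :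
    amplitudeNorm N L Ψ < ∞ := by
  rw [← amplitudeMarginal_zero Ψ (fun i => i.elim0)]
  exact amplitudeMarginal_lt_top hC _

/-! ### The marginal rule (4.13) -/

/-- **Marginal rule in `ℝ≥0∞`** (Tonelli): integrating the last marked particle of the
`(p+1)`-marginal over the cell gives the `p`-marginal,
`∫_{cell} (∫_{cell^{N-p-1}} |Ψ(x, y, Y)| dY) dy = ∫_{cell^{N-p}} |Ψ(x, Y')| dY'`, for measurable
`Ψ` and `p < N`. [cite: Jauslin2025, (4.13)] -/
theorem setLIntegral_amplitudeMarginal_snoc {Ψ : Config N → ℂ} (hΨ : Measurable Ψ)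
    (hp : p < N) (x : Config p) :
    ∫⁻ y in cell L, amplitudeMarginal N (p + 1) L Ψ (Fin.snoc x y) =
      amplitudeMarginal N p L Ψ x := by
  simp only [amplitudeMarginal_eq_lmarginal, padConfig_snoc hp]
  rw [tailSet_eq_insert hp,
    lmarginal_insert _ (measurable_amplitudeWeight hΨ) (notMem_tailSet_succ hp)]

/-- The `(p+1)`-marginal along a snoc is a measurable function of the added particle. [folklore] -/
theorem measurable_amplitudeMarginal_snoc {Ψ : Config N → ℂ} (hΨ : Measurable Ψ)
    (hp : p < N) (x : Config p) :
    Measurable fun y : Space => amplitudeMarginal N (p + 1) L Ψ (Fin.snoc x y) := by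
  have h := (measurable_amplitudeWeight hΨ).lmarginal
    (fun _ : Fin N => (volume : Measure Space).restrict (cell L)) (s := tailSet N (p + 1))
  have hfun : (fun y : Space => amplitudeMarginal N (p + 1) L Ψ (Fin.snoc x y)) =
      fun y => (∫⋯∫⁻_(tailSet N (p + 1)), amplitudeWeight Ψ
        ∂(fun _ : Fin N => (volume : Measure Space).restrict (cell L)))
          (update (padConfig N x) ⟨p, hp⟩ y) := by
    funext y
    rw [amplitudeMarginal_eq_lmarginal, padConfig_snoc hp]
  rw [hfun]
  exact h.comp (measurable_update _)

/-- **Marginal rule for Lieb's correlation functions** [Jauslin2025, (4.13)]: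
`∫_{cell} g_{p+1}(x₁,…,x_p, y) dy = V · g_p(x₁,…,x_p)`, i.e. `∫ dx_{p+1}/V g_{p+1} = g_p`, for a
bounded measurable `Ψ` (e.g. a continuous periodic one) and `p < N`; with `p = 1, 2, 3` (and
`g₁ ≡ 1` for translation-invariant `Ψ`) these are the three rules (4.14) used to fix Lieb's
closures. [cite: Jauslin2025, (4.13)] -/
theorem setIntegral_amplitudeCorrelation_snoc {Ψ : Config N → ℂ} (hΨ : Measurable Ψ)
    (hb : ∃ C : ℝ, ∀ X, ‖Ψ X‖ ≤ C) (hp : p < N) (x : Config p) :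
    ∫ y in cell L, amplitudeCorrelation N (p + 1) L Ψ (Fin.snoc x y) =
      L ^ 3 * amplitudeCorrelation N p L Ψ x := by
  obtain ⟨C, hC⟩ := hb
  simp only [amplitudeCorrelation]
  rw [integral_div, integral_const_mul,
    integral_toReal (measurable_amplitudeMarginal_snoc hΨ hp x).aemeasurable
      (Filter.Eventually.of_forall fun y => amplitudeMarginal_lt_top hC _),
    setLIntegral_amplitudeMarginal_snoc hΨ hp]
  ring

/-- `(x₁, x₂) ⌢ y = (x₁, x₂, y)` in `![…]` notation. [folklore] -/
theorem snoc_vec2 (x₁ x₂ y : Space) : (Fin.snoc ![x₁, x₂] y : Config 3) = ![x₁, x₂, y] := by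
  funext i; fin_cases i <;> rfl

/-- `(x₁, x₂, x₃) ⌢ y = (x₁, x₂, x₃, y)` in `![…]` notation. [folklore] -/
theorem snoc_vec3 (x₁ x₂ x₃ y : Space) :
    (Fin.snoc ![x₁, x₂, x₃] y : Config 4) = ![x₁, x₂, x₃, y] := by
  funext i; fin_cases i <;> rfl

/-- The rule (4.14)₂ behind `h₃`: `∫_{cell} g₃(x₁, x₂, y) dy = V g₂(x₁, x₂)` (bounded measurable `Ψ`,
`N ≥ 3`). [cite: Jauslin2025, (4.14)] -/
theorem setIntegral_amplitudeCorrelation_three {Ψ : Config N → ℂ} (hΨ : Measurable Ψ)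
    (hb : ∃ C : ℝ, ∀ X, ‖Ψ X‖ ≤ C) (hN : 2 < N) (x₁ x₂ : Space) :
    ∫ y in cell L, amplitudeCorrelation N 3 L Ψ ![x₁, x₂, y] =
      L ^ 3 * amplitudeCorrelation N 2 L Ψ ![x₁, x₂] := by
  simpa only [snoc_vec2] using setIntegral_amplitudeCorrelation_snoc hΨ hb hN ![x₁, x₂]

/-- The rule (4.15) behind `h₄`: `∫_{cell} g₄(x₁, x₂, x₃, y) dy = V g₃(x₁, x₂, x₃)` (bounded
measurable `Ψ`, `N ≥ 4`). [cite: Jauslin2025, (4.15)] -/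
theorem setIntegral_amplitudeCorrelation_four {Ψ : Config N → ℂ} (hΨ : Measurable Ψ)
    (hb : ∃ C : ℝ, ∀ X, ‖Ψ X‖ ≤ C) (hN : 3 < N) (x₁ x₂ x₃ : Space) :
    ∫ y in cell L, amplitudeCorrelation N 4 L Ψ ![x₁, x₂, x₃, y] =
      L ^ 3 * amplitudeCorrelation N 3 L Ψ ![x₁, x₂, x₃] := by
  simpa only [snoc_vec3] using setIntegral_amplitudeCorrelation_snoc hΨ hb hN ![x₁, x₂, x₃]

/-! ### Elementary properties -/

/-- `g₀ = 1` as soon as `0 < ∫_{cell^N}|Ψ| < ∞`. [cite: Jauslin2025, (4.9)] -/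
theorem amplitudeCorrelation_zero {Ψ : Config N → ℂ} (h0 : amplitudeNorm N L Ψ ≠ 0)
    (htop : amplitudeNorm N L Ψ ≠ ∞) (x : Config 0) : amplitudeCorrelation N 0 L Ψ x = 1 := by
  rw [amplitudeCorrelation, amplitudeMarginal_zero, pow_zero, one_mul, div_self]
  exact ENNReal.toReal_ne_zero.2 ⟨h0, htop⟩

/-- `g_p ≥ 0` (for `L ≥ 0`). [cite: Jauslin2025, (4.9)] -/
theorem amplitudeCorrelation_nonneg (hL : 0 ≤ L) (Ψ : Config N → ℂ) (x : Config p) :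
    0 ≤ amplitudeCorrelation N p L Ψ x :=
  div_nonneg (mul_nonneg (pow_nonneg (pow_nonneg hL 3) p) ENNReal.toReal_nonneg)
    ENNReal.toReal_nonneg

/-- `h₃ = 0` iff `g₃` is the Kirkwood superposition of `g₂` (pointwise). [cite: Jauslin2025, Assumption 4.1 (4.11)] -/
theorem truncatedCorrelation3_eq_zero_iff (Ψ : Config N → ℂ) (x : Config 3) :
    truncatedCorrelation3 N L Ψ x = 0 ↔
      amplitudeCorrelation N 3 L Ψ x = kirkwoodSuperposition (pairCorrelation N L Ψ) x :=
  sub_eq_zero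

/-! ### The amplitude gas as a probability measure -/

/-- **`E_ν[f] = ∫ f dν`**: the expectation is the integral against the amplitude-gas measure
(for measurable `Ψ`). [cite: Jauslin2025, §4.2.1] -/
theorem integral_amplitudeMeasure {Ψ : Config N → ℂ} (hΨ : Measurable Ψ) (f : Config N → ℝ) :
    ∫ X, f X ∂amplitudeMeasure N L Ψ = amplitudeExpectation N L Ψ f := by
  rw [amplitudeMeasure, integral_smul_measure, amplitudeExpectation,
    integral_withDensity_eq_integral_smul hΨ.nnnorm, ENNReal.toReal_inv, smul_eq_mul,
    inv_mul_eq_div]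
  congr 1

/-- The amplitude gas is a probability measure as soon as `0 < ∫_{cell^N}|Ψ| < ∞` (e.g. `Ψ`
bounded, not a.e. zero on the cell, `L > 0`). [cite: Jauslin2025, §4.2.1] -/
theorem isProbabilityMeasure_amplitudeMeasure {Ψ : Config N → ℂ}
    (h0 : amplitudeNorm N L Ψ ≠ 0) (htop : amplitudeNorm N L Ψ ≠ ∞) :
    IsProbabilityMeasure (amplitudeMeasure N L Ψ) := by
  refine ⟨?_⟩
  rw [amplitudeMeasure, Measure.smul_apply, withDensity_apply _ MeasurableSet.univ,
    Measure.restrict_univ, smul_eq_mul]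
  exact ENNReal.inv_mul_cancel h0 htop

end Literature.MathematicalPhysics.QuantumManyBody.BoseGas

end
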